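import Summits.KontsevichZagierPeriods.KontsevichZagierPeriods.Theorems.RootDecompRationalCubeDichotomyRankDescentP08

/-! # `RootDecompRationalCubeDichotomyRankDescentP09` — part 9/14 of the mechanical ≤400-line split of `RankDescent_v12_landing.lean` (sha256 00885b8b9882f02e…)
Source: decomp-kz lens-2 g13 `RankDescent_v12.lean` (HOME/decomp-kz-lens-2/g13/, sha256 00885b8b…; critic g5-18…g5-66 CLEARED as NODE v1–v12 for crux stmt-KontsevichZagierPeriods-26322 RationalCubePiKernelSingle: rank dichotomy single_of_fullRankGeTwo + RankLeOneKernel, de Rham-exact descent, linear-in-one-variable / hyperbola / Fermat–hyperbolic / conic classes, transport kit, Brieskorn module; writer g7 l.1222: «landing split §0–4 ∣ … ∣ §16 --supports 26322 endorsed»); `#print axioms` pins removed; landed by census-1 g9.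
Split by census-1 g9 `gen/splitlean.py`: scopes re-opened with their `open`/`variable`/`set_option` context; mathematics and declaration order unchanged. -/

noncomputable section
open MeasureTheory Set MvPolynomial
open Literature.NumberTheory.Transcendental
open Literature.NumberTheory.Transcendental.KZ
namespace Summit.KontsevichZagierPeriods.RootDecompRationalCubeDichotomy.Rung26322.RankDescent
variable {M : ℕ}

/-- **DECIDED (m = 2, PROVED, N = 0): reducible x-linear denominators `c·(x + A₁(y))(y + β)`, corner value zero.** [cite: KontsevichZagier2001, §1.2] -/
theorem lineGraph_two_mem_relations (c : ℚ) (hc : c ≠ 0) (β : ℚ) (A₀ : MvPolynomial (Fin 1) ℚ)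
    (q : IntegralRep 2) (P : MvPolynomial (Fin 2) ℚ)
    (hP : MvPolynomial.eval ![(0:ℚ), 0] (aeval ![X 0 - evalAt A₀ (X 1 + C (-β)), X 1 + C (-β)] (C c⁻¹ * P)) = 0)
    (hd : q.domain = Set.pi Set.univ (fun _ : Fin 2 => Set.Icc (0:ℝ) 1))
    (hQ : ∀ z ∈ Set.pi Set.univ (fun _ : Fin 2 => Set.Icc (0:ℝ) 1),
      MvPolynomial.aeval z (C c * ((X 0 + evalAt A₀ (X 1 + C 0)) * (X 1 + C β)) : MvPolynomial (Fin 2) ℚ) ≠ 0)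
    (hf : ∀ z ∈ Set.pi Set.univ (fun _ : Fin 2 => Set.Icc (0:ℝ) 1),
      q.integrand z = MvPolynomial.aeval z P
        / MvPolynomial.aeval z (C c * ((X 0 + evalAt A₀ (X 1 + C 0)) * (X 1 + C β)) : MvPolynomial (Fin 2) ℚ))
    (h0 : q.value = 0) : of q ∈ relations := by
  have hf' := integrand_rescale c hc hf
  have hQ' := zeroFree_rescale c hc hQ
  have hcc : (C c⁻¹ * (C c * ((X 0 + evalAt A₀ (X 1 + C 0)) * (X 1 + C β))) : MvPolynomial (Fin 2) ℚ)
      = (X 0 + evalAt A₀ (X 1 + C 0)) * (X 1 + C β) := by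
    rw [← mul_assoc, ← map_mul, inv_mul_cancel₀ hc, map_one, one_mul]
  rw [hcc] at hf' hQ'
  obtain ⟨s, G, hid⟩ := drExact_lineGraph β A₀ _ hP
  exact mem_relations_of_exact_two q _ _ s G hid hd hQ' hf' h0

/-- Residual, irreducible x-linear class: functional NON-ZERO (one rational parameter per denominator). [folklore] -/
def XLinTResidual (c a₀ β : ℚ) (A₀ : MvPolynomial (Fin 1) ℚ) : Prop :=
  ∀ (q : IntegralRep 2) (P : MvPolynomial (Fin 2) ℚ),
    diagAlt a₀ (aeval ![X 0 - evalAt A₀ (X 1 + C (-β)), X 1 + C (-β)] (C c⁻¹ * P)) ≠ 0 →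
    q.domain = Set.pi Set.univ (fun _ : Fin 2 => Set.Icc (0:ℝ) 1) →
    (∀ z ∈ Set.pi Set.univ (fun _ : Fin 2 => Set.Icc (0:ℝ) 1),
      MvPolynomial.aeval z (C c * (C a₀ + (X 0 + evalAt A₀ (X 1 + C 0)) * (X 1 + C β)) : MvPolynomial (Fin 2) ℚ) ≠ 0) →
    (∀ z ∈ Set.pi Set.univ (fun _ : Fin 2 => Set.Icc (0:ℝ) 1),
      q.integrand z = MvPolynomial.aeval z P
        / MvPolynomial.aeval z (C c * (C a₀ + (X 0 + evalAt A₀ (X 1 + C 0)) * (X 1 + C β)) : MvPolynomial (Fin 2) ℚ)) →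
    q.value = 0 → ∃ N : ℕ, (fun y : FormalRep => of piRep * y)^[N] (of q) ∈ relations

/-- Residual, reducible x-linear class: corner value NON-ZERO (one rational parameter per denominator). [folklore] -/
def LineGraphResidual (c β : ℚ) (A₀ : MvPolynomial (Fin 1) ℚ) : Prop :=
  ∀ (q : IntegralRep 2) (P : MvPolynomial (Fin 2) ℚ),
    MvPolynomial.eval ![(0:ℚ), 0] (aeval ![X 0 - evalAt A₀ (X 1 + C (-β)), X 1 + C (-β)] (C c⁻¹ * P)) ≠ 0 →
    q.domain = Set.pi Set.univ (fun _ : Fin 2 => Set.Icc (0:ℝ) 1) →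
    (∀ z ∈ Set.pi Set.univ (fun _ : Fin 2 => Set.Icc (0:ℝ) 1),
      MvPolynomial.aeval z (C c * ((X 0 + evalAt A₀ (X 1 + C 0)) * (X 1 + C β)) : MvPolynomial (Fin 2) ℚ) ≠ 0) →
    (∀ z ∈ Set.pi Set.univ (fun _ : Fin 2 => Set.Icc (0:ℝ) 1),
      q.integrand z = MvPolynomial.aeval z P
        / MvPolynomial.aeval z (C c * ((X 0 + evalAt A₀ (X 1 + C 0)) * (X 1 + C β)) : MvPolynomial (Fin 2) ℚ)) →
    q.value = 0 → ∃ N : ℕ, (fun y : FormalRep => of piRep * y)^[N] (of q) ∈ relations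

/-- **26322 on an irreducible x-linear denominator ⟸ its one-parameter residual (PROVED split).** [folklore] -/
theorem xlinT_single_of_residual (c : ℚ) (hc : c ≠ 0) (a₀ β : ℚ) (A₀ : MvPolynomial (Fin 1) ℚ)
    (h : XLinTResidual c a₀ β A₀) (q : IntegralRep 2) (P : MvPolynomial (Fin 2) ℚ)
    (hd : q.domain = Set.pi Set.univ (fun _ : Fin 2 => Set.Icc (0:ℝ) 1))
    (hQ : ∀ z ∈ Set.pi Set.univ (fun _ : Fin 2 => Set.Icc (0:ℝ) 1),
      MvPolynomial.aeval z (C c * (C a₀ + (X 0 + evalAt A₀ (X 1 + C 0)) * (X 1 + C β)) : MvPolynomial (Fin 2) ℚ) ≠ 0)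
    (hf : ∀ z ∈ Set.pi Set.univ (fun _ : Fin 2 => Set.Icc (0:ℝ) 1),
      q.integrand z = MvPolynomial.aeval z P
        / MvPolynomial.aeval z (C c * (C a₀ + (X 0 + evalAt A₀ (X 1 + C 0)) * (X 1 + C β)) : MvPolynomial (Fin 2) ℚ))
    (h0 : q.value = 0) : ∃ N : ℕ, (fun y : FormalRep => of piRep * y)^[N] (of q) ∈ relations := by
  by_cases hP : diagAlt a₀ (aeval ![X 0 - evalAt A₀ (X 1 + C (-β)), X 1 + C (-β)] (C c⁻¹ * P)) = 0
  · exact ⟨0, by simpa using xlinT_two_mem_relations c hc a₀ β A₀ q P hP hd hQ hf h0⟩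
  · exact h q P hP hd hQ hf h0

/-- **26322 on a reducible x-linear denominator ⟸ its one-parameter residual (PROVED split).** [folklore] -/
theorem lineGraph_single_of_residual (c : ℚ) (hc : c ≠ 0) (β : ℚ) (A₀ : MvPolynomial (Fin 1) ℚ)
    (h : LineGraphResidual c β A₀) (q : IntegralRep 2) (P : MvPolynomial (Fin 2) ℚ)
    (hd : q.domain = Set.pi Set.univ (fun _ : Fin 2 => Set.Icc (0:ℝ) 1))
    (hQ : ∀ z ∈ Set.pi Set.univ (fun _ : Fin 2 => Set.Icc (0:ℝ) 1),
      MvPolynomial.aeval z (C c * ((X 0 + evalAt A₀ (X 1 + C 0)) * (X 1 + C β)) : MvPolynomial (Fin 2) ℚ) ≠ 0)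
    (hf : ∀ z ∈ Set.pi Set.univ (fun _ : Fin 2 => Set.Icc (0:ℝ) 1),
      q.integrand z = MvPolynomial.aeval z P
        / MvPolynomial.aeval z (C c * ((X 0 + evalAt A₀ (X 1 + C 0)) * (X 1 + C β)) : MvPolynomial (Fin 2) ℚ))
    (h0 : q.value = 0) : ∃ N : ℕ, (fun y : FormalRep => of piRep * y)^[N] (of q) ∈ relations := by
  by_cases hP : MvPolynomial.eval ![(0:ℚ), 0] (aeval ![X 0 - evalAt A₀ (X 1 + C (-β)), X 1 + C (-β)] (C c⁻¹ * P)) = 0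
  · exact ⟨0, by simpa using lineGraph_two_mem_relations c hc β A₀ q P hP hd hQ hf h0⟩
  · exact h q P hP hd hQ hf h0

/-! ### §11b Census instances (reducible / translated rows of census-m2-v1)
`1 + 2x + 2y + 2xy + y² = 2·(x + (1 + y)/2)·(y + 1)` (line × graph, `c = 2`, `β = 1`, `A₁(y) = (1 + y)/2`; census `Li₂(−1/2)`
class): corner `(0, −1)`, functional `P ↦ P(0, −1)/2`; `2 + y + xy = 1·(2 + (x + 0)(y + 1))` (irreducible, `a₀ = 2, β = 1, A₁ = 0`):
functional `P ↦ diagAlt 2 (P(x, y − 1))`. -/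

/-- `evalAt` on an affine `A₀ = C u + C v * X 0`: `A₀(t) = u + v t`. [folklore] -/
theorem evalAt_affine (u v : ℚ) (t : MvPolynomial (Fin 2) ℚ) :
    evalAt (C u + C v * X 0) t = C u + C v * t := by
  simp [evalAt, MvPolynomial.algebraMap_eq]

/-- On `(1 + y)(1 + 2x + y) = 2·(x + (1+y)/2)·(y + 1)`: the numerator `y + 1` has functional 0 — indeed
`(y+1)/((1+y)(1+2x+y)) = 1/(1+2x+y)` is exact (decided, N = 0). [folklore] -/
example : MvPolynomial.eval ![(0:ℚ), 0] (aeval ![X 0 - evalAt (C (1/2:ℚ) + C (1/2:ℚ) * X 0) (X 1 + C (-1)), X 1 + C (-1)]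
    (C (2:ℚ)⁻¹ * (X 1 + C 1 : MvPolynomial (Fin 2) ℚ))) = 0 := by
  simp [evalAt_affine, MvPolynomial.algebraMap_eq]

/-- … while `1` has functional `1/2 ≠ 0` (the generator of the class; census value in the `Li₂(−1/2)` family). [folklore] -/
example : MvPolynomial.eval ![(0:ℚ), 0] (aeval ![X 0 - evalAt (C (1/2:ℚ) + C (1/2:ℚ) * X 0) (X 1 + C (-1)), X 1 + C (-1)]
    (C (2:ℚ)⁻¹ * (1 : MvPolynomial (Fin 2) ℚ))) = 1/2 := by
  simp [MvPolynomial.algebraMap_eq]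

/-- On `2 + y + xy = 2 + (x + 0)(y + 1)` (irreducible, `a₀ = 2`, `β = 1`, `A₁ = 0`): `xy − x + 2 ↦ diagAlt 2 (xy − 2x + 2) = −2 + 2 = 0`,
so `(xy − x + 2)/(2 + y + xy)` is exact (decided, N = 0); the generator `1 ↦ 1`. [folklore] -/
example : diagAlt 2 (aeval ![X 0 - evalAt (0 : MvPolynomial (Fin 1) ℚ) (X 1 + C (-1)), X 1 + C (-1)]
    (C (1:ℚ)⁻¹ * (X 0 * X 1 - X 0 + C 2 : MvPolynomial (Fin 2) ℚ))) = 0 := by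
  have h : aeval ![X 0 - evalAt (0 : MvPolynomial (Fin 1) ℚ) (X 1 + C (-1)), X 1 + C (-1)]
      (C (1:ℚ)⁻¹ * (X 0 * X 1 - X 0 + C 2 : MvPolynomial (Fin 2) ℚ)) = X 0 * X 1 - C 2 * X 0 + C 2 := by
    simp [evalAt, MvPolynomial.algebraMap_eq]
    simp only [map_ofNat]
    ring
  rw [h, diagAlt_add, diagAlt_sub, diagAlt_C_mul, diagAlt_XX, diagAlt_X, diagAlt_C]
  ring

/-! Swapped orientations (`y`-degree one): compose with `drExact_rename_equiv (Equiv.swap 0 1)` exactly as in `drExact_ylin`. -/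

/-! ## §12 (v8) GENERAL AFFINE TRANSPORT; conics with RATIONAL points at infinity

An invertible affine substitution `σ = (a x + b y + e, c x + d y + e')`, `Δ = ad − bc ≠ 0`, has Jacobian `Δ`; `drExact_affine` transports
certificates along it and `aff_unaff` inverts it. Three base classes then spread over the plane:
* the graph `X 0 + A₀(X 1)` of §6 (ALL numerators exact) ↦ **`Q = L₁ + A₀(L₂)`** for independent affine forms `L₁, L₂` — this contains every
  PARABOLA-type conic `(αx + βy)² + γx + δy + ε` with `(γ, δ) ∦ (α, β)`: 26322 DECIDED for ALL numerators (`affineGraph_two_mem_relations`);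
* the hyperbola `a₀ + X 0·X 1` of §8 ↦ **`Q = a₀ + L₁·L₂`** — every conic whose quadratic part SPLITS over `ℚ` (two rational points at infinity),
  irreducible case: functional `diagAlt a₀ ∘ σ⁻¹`, decided codimension one + one parameter (`splitConic_two_mem_relations`, `SplitConicResidual`);
* the grid `X 0·X 1` of §7 ↦ **`Q = L₁·L₂`** (two crossing rational lines): functional `P(L₁ ∩ L₂)` (`linePair_two_mem_relations`, `LinePairResidual`).
What remains of the census box after §6–§12: conics whose quadratic part is IRREDUCIBLE over `ℚ` (e.g. `x² + y²`, `2x² + 2xy + y²`, `x² + xy + y²`: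
the Serret `π·log 2` and Catalan classes) — `NonExactKernelGeTwo`, pointer 0096. -/

/-- The affine substitution `(x, y) ↦ (a x + b y + e, c x + d y + e')`. -/
def affMap (a b e c d e' : ℚ) : Fin 2 → MvPolynomial (Fin 2) ℚ :=
  ![C a * X 0 + C b * X 1 + C e, C c * X 0 + C d * X 1 + C e']

/-- Its inverse (for `Δ = ad − bc ≠ 0`). -/
def affInv (a b e c d e' : ℚ) : Fin 2 → MvPolynomial (Fin 2) ℚ :=
  ![C (d / (a * d - b * c)) * (X 0 - C e) - C (b / (a * d - b * c)) * (X 1 - C e'),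
    C (a / (a * d - b * c)) * (X 1 - C e') - C (c / (a * d - b * c)) * (X 0 - C e)]

/-- Auxiliary step `jac_affMap` (§12): jac aff Map. [bookkeeping] -/
theorem jac_affMap (a b e c d e' : ℚ) :
    pderiv 0 (affMap a b e c d e' 0) * pderiv 1 (affMap a b e c d e' 1)
      - pderiv 1 (affMap a b e c d e' 0) * pderiv 0 (affMap a b e c d e' 1) = C (a * d - b * c) := by
  simp [affMap]

/-- **Affine transport**: `DRExact P Q → DRExact (σP · Δ) (σQ)`. [folklore] -/
theorem drExact_affine (a b e c d e' : ℚ) {P Q : MvPolynomial (Fin 2) ℚ} (h : DRExact P Q) :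
    DRExact (aeval (affMap a b e c d e') P * C (a * d - b * c)) (aeval (affMap a b e c d e') Q) := by
  have := drExact_transport (affMap a b e c d e') h
  rwa [jac_affMap] at this

/-- `σ ∘ σ⁻¹ = id`. [folklore] -/
theorem aff_unaff (a b e c d e' : ℚ) (hΔ : a * d - b * c ≠ 0) (P : MvPolynomial (Fin 2) ℚ) :
    aeval (affMap a b e c d e') (aeval (affInv a b e c d e') P) = P := by
  set Δ := a * d - b * c with hΔdef
  have h1 : d / Δ * a - b / Δ * c = 1 := by
    rw [div_mul_eq_mul_div, div_mul_eq_mul_div, ← sub_div, div_eq_one_iff_eq hΔ, hΔdef]; ring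
  have h2 : d / Δ * b - b / Δ * d = 0 := by ring
  have h3 : a / Δ * d - c / Δ * b = 1 := by
    rw [div_mul_eq_mul_div, div_mul_eq_mul_div, ← sub_div, div_eq_one_iff_eq hΔ, hΔdef]; ring
  have h4 : a / Δ * c - c / Δ * a = 0 := by ring
  rw [← AlgHom.comp_apply, comp_aeval]
  have : (fun i => aeval (affMap a b e c d e') (affInv a b e c d e' i)) = (X : Fin 2 → MvPolynomial (Fin 2) ℚ) := by
    funext i
    fin_cases i
    · show aeval (affMap a b e c d e') (affInv a b e c d e' 0) = X 0
      have : aeval (affMap a b e c d e') (affInv a b e c d e' 0)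
          = C (d / Δ * a - b / Δ * c) * X 0 + C (d / Δ * b - b / Δ * d) * X 1 := by
        simp only [affMap, affInv, Matrix.cons_val_zero, Matrix.cons_val_one, map_sub, map_mul,
          MvPolynomial.aeval_C, MvPolynomial.algebraMap_eq, aeval_X]
        ring
      rw [this, h1, h2, C_1, C_0, one_mul, zero_mul, add_zero]
    · show aeval (affMap a b e c d e') (affInv a b e c d e' 1) = X 1
      have : aeval (affMap a b e c d e') (affInv a b e c d e' 1)
          = C (a / Δ * d - c / Δ * b) * X 1 + C (a / Δ * c - c / Δ * a) * X 0 := by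
        simp only [affMap, affInv, Matrix.cons_val_zero, Matrix.cons_val_one, map_sub, map_mul,
          MvPolynomial.aeval_C, MvPolynomial.algebraMap_eq, aeval_X]
        ring
      rw [this, h3, h4, C_1, C_0, one_mul, zero_mul, add_zero]
  rw [this, aeval_X_left, AlgHom.id_apply]

/-- `P = σ(Δ⁻¹·σ⁻¹P)·Δ`. [folklore] -/
theorem eq_aff_unaff (a b e c d e' : ℚ) (hΔ : a * d - b * c ≠ 0) (P : MvPolynomial (Fin 2) ℚ) :
    aeval (affMap a b e c d e') (C (a * d - b * c)⁻¹ * aeval (affInv a b e c d e') P) * C (a * d - b * c) = P := by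
  rw [map_mul, aff_unaff a b e c d e' hΔ P, MvPolynomial.aeval_C, MvPolynomial.algebraMap_eq, mul_assoc, mul_comm P,
    ← mul_assoc, ← map_mul, inv_mul_cancel₀ hΔ, C_1, one_mul]

/-- **AFFINE GRAPHS `Q = L₁ + A₀(L₂)`** (`L₁ = ax + by + e`, `L₂ = cx + dy + e'` independent): EVERY numerator is exact — this contains every
parabola-type conic `(αx+βy)² + γx + δy + ε`, `(γ,δ) ∦ (α,β)`. [folklore] -/
theorem drExact_affineGraph (a b e c d e' : ℚ) (hΔ : a * d - b * c ≠ 0) (A₀ : MvPolynomial (Fin 1) ℚ)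
    (P : MvPolynomial (Fin 2) ℚ) :
    DRExact P (affMap a b e c d e' 0 + evalAt A₀ (affMap a b e c d e' 1)) := by
  have h1 := drExact_of_monicLinear (0 : Fin 1) A₀ (C (a * d - b * c)⁻¹ * aeval (affInv a b e c d e') P)
  have h2 := drExact_affine a b e c d e' h1
  rw [eq_aff_unaff a b e c d e' hΔ] at h2
  have hQ : aeval (affMap a b e c d e') (X 0 + rename Fin.succ A₀ : MvPolynomial (Fin 2) ℚ)
      = affMap a b e c d e' 0 + evalAt A₀ (affMap a b e c d e' 1) := by
    rw [map_add, aeval_X, aeval_rename]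
    unfold evalAt
    have hf : (affMap a b e c d e' ∘ Fin.succ) = (fun _ : Fin 1 => affMap a b e c d e' 1) := by
      funext i
      fin_cases i
      rfl
    rw [hf]
  rwa [hQ] at h2

/-- **DECIDED (m = 2, PROVED, N = 0), ALL NUMERATORS: `Q = k·(L₁ + A₀(L₂))`** — affine graphs, in particular all parabola-type conics. [cite: KontsevichZagier2001, §1.2] -/
theorem affineGraph_two_mem_relations (k : ℚ) (hk : k ≠ 0) (a b e c d e' : ℚ) (hΔ : a * d - b * c ≠ 0)
    (A₀ : MvPolynomial (Fin 1) ℚ) (q : IntegralRep 2) (P : MvPolynomial (Fin 2) ℚ)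
    (hd : q.domain = Set.pi Set.univ (fun _ : Fin 2 => Set.Icc (0:ℝ) 1))
    (hQ : ∀ z ∈ Set.pi Set.univ (fun _ : Fin 2 => Set.Icc (0:ℝ) 1),
      MvPolynomial.aeval z (C k * (affMap a b e c d e' 0 + evalAt A₀ (affMap a b e c d e' 1))) ≠ 0)
    (hf : ∀ z ∈ Set.pi Set.univ (fun _ : Fin 2 => Set.Icc (0:ℝ) 1),
      q.integrand z = MvPolynomial.aeval z P
        / MvPolynomial.aeval z (C k * (affMap a b e c d e' 0 + evalAt A₀ (affMap a b e c d e' 1))))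
    (h0 : q.value = 0) : of q ∈ relations := by
  have hf' := integrand_rescale k hk hf
  have hQ' := zeroFree_rescale k hk hQ
  have hcc : C k⁻¹ * (C k * (affMap a b e c d e' 0 + evalAt A₀ (affMap a b e c d e' 1)))
      = affMap a b e c d e' 0 + evalAt A₀ (affMap a b e c d e' 1) := by
    rw [← mul_assoc, ← map_mul, inv_mul_cancel₀ hk, map_one, one_mul]
  rw [hcc] at hf' hQ'
  obtain ⟨s, G, hid⟩ := drExact_affineGraph a b e c d e' hΔ A₀ (C k⁻¹ * P)
  exact mem_relations_of_exact_two q _ _ s G hid hd hQ' hf' h0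

/-- **SPLIT CONICS `Q = a₀ + L₁·L₂`** (quadratic part split over ℚ, `Δ ≠ 0`; irreducible iff `a₀ ≠ 0`): functional
`P ↦ diagAlt a₀ (σ⁻¹P)`; zero ⟹ exact. [folklore] -/
theorem drExact_splitConic (a₀ a b e c d e' : ℚ) (hΔ : a * d - b * c ≠ 0) (P : MvPolynomial (Fin 2) ℚ)
    (h : diagAlt a₀ (aeval (affInv a b e c d e') P) = 0) :
    DRExact P (C a₀ + affMap a b e c d e' 0 * affMap a b e c d e' 1) := by
  have h' : diagAlt a₀ (C (a * d - b * c)⁻¹ * aeval (affInv a b e c d e') P) = 0 := by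
    rw [diagAlt_C_mul, h, mul_zero]
  have h1 := drExact_hyperbola a₀ _ h'
  have h2 := drExact_affine a b e c d e' h1
  rw [eq_aff_unaff a b e c d e' hΔ] at h2
  have hQ : aeval (affMap a b e c d e') (C a₀ + X 0 * X 1 : MvPolynomial (Fin 2) ℚ)
      = C a₀ + affMap a b e c d e' 0 * affMap a b e c d e' 1 := by
    rw [map_add, map_mul, aeval_X, aeval_X, MvPolynomial.aeval_C, MvPolynomial.algebraMap_eq]
  rwa [hQ] at h2

/-- **LINE PAIRS `Q = L₁·L₂`** (two crossing rational lines): functional `P ↦ (σ⁻¹P)(0,0) = P(L₁ ∩ L₂)`; zero ⟹ exact. [folklore] -/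
theorem drExact_linePair (a b e c d e' : ℚ) (hΔ : a * d - b * c ≠ 0) (P : MvPolynomial (Fin 2) ℚ)
    (h : MvPolynomial.eval ![(0:ℚ), 0] (aeval (affInv a b e c d e') P) = 0) :
    DRExact P (affMap a b e c d e' 0 * affMap a b e c d e' 1) := by
  have h' : MvPolynomial.eval ![-(0:ℚ), -0] (C (a * d - b * c)⁻¹ * aeval (affInv a b e c d e') P) = 0 := by
    rw [neg_zero, map_mul, h, mul_zero]
  have h1 := drExact_of_corner 0 0 _ h'
  have h2 := drExact_affine a b e c d e' h1
  rw [eq_aff_unaff a b e c d e' hΔ] at h2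
  have hQ : aeval (affMap a b e c d e') ((X 0 + C 0) * (X 1 + C 0) : MvPolynomial (Fin 2) ℚ)
      = affMap a b e c d e' 0 * affMap a b e c d e' 1 := by
    rw [C_0, add_zero, add_zero, map_mul, aeval_X, aeval_X]
  rwa [hQ] at h2

/-- **DECIDED (m = 2, PROVED, N = 0): split conics `k·(a₀ + L₁L₂)`, functional zero.** [cite: KontsevichZagier2001, §1.2] -/
theorem splitConic_two_mem_relations (k : ℚ) (hk : k ≠ 0) (a₀ a b e c d e' : ℚ) (hΔ : a * d - b * c ≠ 0)
    (q : IntegralRep 2) (P : MvPolynomial (Fin 2) ℚ)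
    (hP : diagAlt a₀ (aeval (affInv a b e c d e') (C k⁻¹ * P)) = 0)
    (hd : q.domain = Set.pi Set.univ (fun _ : Fin 2 => Set.Icc (0:ℝ) 1))
    (hQ : ∀ z ∈ Set.pi Set.univ (fun _ : Fin 2 => Set.Icc (0:ℝ) 1),
      MvPolynomial.aeval z (C k * (C a₀ + affMap a b e c d e' 0 * affMap a b e c d e' 1)) ≠ 0)
    (hf : ∀ z ∈ Set.pi Set.univ (fun _ : Fin 2 => Set.Icc (0:ℝ) 1),
      q.integrand z = MvPolynomial.aeval z P
        / MvPolynomial.aeval z (C k * (C a₀ + affMap a b e c d e' 0 * affMap a b e c d e' 1)))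
    (h0 : q.value = 0) : of q ∈ relations := by
  have hf' := integrand_rescale k hk hf
  have hQ' := zeroFree_rescale k hk hQ
  have hcc : C k⁻¹ * (C k * (C a₀ + affMap a b e c d e' 0 * affMap a b e c d e' 1))
      = C a₀ + affMap a b e c d e' 0 * affMap a b e c d e' 1 := by
    rw [← mul_assoc, ← map_mul, inv_mul_cancel₀ hk, map_one, one_mul]
  rw [hcc] at hf' hQ'
  obtain ⟨s, G, hid⟩ := drExact_splitConic a₀ a b e c d e' hΔ _ hP
  exact mem_relations_of_exact_two q _ _ s G hid hd hQ' hf' h0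

/-- **DECIDED (m = 2, PROVED, N = 0): line pairs `k·L₁L₂`, crossing-point value zero.** [cite: KontsevichZagier2001, §1.2] -/
theorem linePair_two_mem_relations (k : ℚ) (hk : k ≠ 0) (a b e c d e' : ℚ) (hΔ : a * d - b * c ≠ 0)
    (q : IntegralRep 2) (P : MvPolynomial (Fin 2) ℚ)
    (hP : MvPolynomial.eval ![(0:ℚ), 0] (aeval (affInv a b e c d e') (C k⁻¹ * P)) = 0)
    (hd : q.domain = Set.pi Set.univ (fun _ : Fin 2 => Set.Icc (0:ℝ) 1))
    (hQ : ∀ z ∈ Set.pi Set.univ (fun _ : Fin 2 => Set.Icc (0:ℝ) 1),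
      MvPolynomial.aeval z (C k * (affMap a b e c d e' 0 * affMap a b e c d e' 1)) ≠ 0)
    (hf : ∀ z ∈ Set.pi Set.univ (fun _ : Fin 2 => Set.Icc (0:ℝ) 1),
      q.integrand z = MvPolynomial.aeval z P
        / MvPolynomial.aeval z (C k * (affMap a b e c d e' 0 * affMap a b e c d e' 1)))
    (h0 : q.value = 0) : of q ∈ relations := by
  have hf' := integrand_rescale k hk hf
  have hQ' := zeroFree_rescale k hk hQ
  have hcc : C k⁻¹ * (C k * (affMap a b e c d e' 0 * affMap a b e c d e' 1))
      = affMap a b e c d e' 0 * affMap a b e c d e' 1 := by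
    rw [← mul_assoc, ← map_mul, inv_mul_cancel₀ hk, map_one, one_mul]
  rw [hcc] at hf' hQ'
  obtain ⟨s, G, hid⟩ := drExact_linePair a b e c d e' hΔ _ hP
  exact mem_relations_of_exact_two q _ _ s G hid hd hQ' hf' h0

/-- Residual of the split-conic class: functional NON-ZERO (one rational parameter per conic). [folklore] -/
def SplitConicResidual (k a₀ a b e c d e' : ℚ) : Prop :=
  ∀ (q : IntegralRep 2) (P : MvPolynomial (Fin 2) ℚ),
    diagAlt a₀ (aeval (affInv a b e c d e') (C k⁻¹ * P)) ≠ 0 →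
    q.domain = Set.pi Set.univ (fun _ : Fin 2 => Set.Icc (0:ℝ) 1) →
    (∀ z ∈ Set.pi Set.univ (fun _ : Fin 2 => Set.Icc (0:ℝ) 1),
      MvPolynomial.aeval z (C k * (C a₀ + affMap a b e c d e' 0 * affMap a b e c d e' 1)) ≠ 0) →
    (∀ z ∈ Set.pi Set.univ (fun _ : Fin 2 => Set.Icc (0:ℝ) 1),
      q.integrand z = MvPolynomial.aeval z P
        / MvPolynomial.aeval z (C k * (C a₀ + affMap a b e c d e' 0 * affMap a b e c d e' 1))) →
    q.value = 0 → ∃ N : ℕ, (fun y : FormalRep => of piRep * y)^[N] (of q) ∈ relations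

end Summit.KontsevichZagierPeriods.RootDecompRationalCubeDichotomy.Rung26322.RankDescent
end
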